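import Literature.NumberTheory.ComplexMultiplication.CMTypeRankTypeConjugation
import HarnessLib

/-!
# Stabiliser separation for a QUADRATIC TOWER: a nondegenerate type of the top slot is stabilised by an element
# moving every type of the bottom slot

Companion of `NumberTheory/ComplexMultiplication/CMTypeRankTypeConjugation` §2 (stabiliser separation: an element
`g ∈ G` with `g⁻¹Θ = Θ` for the type `Θ` of one slot and `g⁻¹Ψ ≠ Ψ` for the type `Ψ` of the other slot, together with
the irreducibility of `U(Ψ)`, gives `rank(Ψ, Θ) − 1 = (rank Ψ − 1) + (rank Θ − 1)` — although `U(Ψ)` and `U(Θ)` may well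
SHARE a constituent, so that no partial conjugation and no "no common constituent" argument is available).  This file
PRODUCES such a `g` in the situation of a quadratic tower of CM fields `K ⊂ K'`, `[K' : K] = 2`, abstractly: two
`G`-sets `X` (`= Hom(K, ℂ)`) and `Y` (`= Hom(K', ℂ)`) with a commuting conjugation `ρ`, an equivariant map `π : Y → X`
(restriction) whose fibres have two elements swapped by elements of `G` acting trivially on `X` (`K' ⊄` the Galois
closure of `K`), `X` consisting of two conjugate pairs `{x, ρx, x', ρx'}` (`[K : ℚ] = 4`) on which `G` realises the
"pair conjugations" `x ↦ x`, `x' ↦ ρx'` (the reflections of the dihedral group of a non-Galois quartic CM field), a CM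
type `Ψ ⊆ X` and a NONDEGENERATE CM type `Θ ⊆ Y`.

> **Theorem** (`exists_typeStab_and_not_of_quadraticTower`).  Some `g ∈ G` satisfies `g⁻¹Θ = Θ` and `g⁻¹Ψ ≠ Ψ`.

PROOF.  Nondegenerate types separate points (Kubota, the tree's `eq_of_forall_smul_mem_iff_of_typeRank_eq`), whence
(§1) some fibre `{y₀, y₀'}` of `π` lies inside `Θ` (else `y ↦` its fibre mate composed with `ρ` would not be separated
from `y`) and some fibre `{y₁, y₁'}` meets `Θ` in exactly `y₁` (else `Θ` would be a union of fibres, i.e. induced from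
`K`, and `y`, `y'` would not be separated).  Then `x₁ = π y₁ ∉ {x₀, ρx₀}` (`x₀ = π y₀`), and the pair conjugation `g₁`
(`g₁x₀ = x₀`, `g₁x₁ = ρx₁`), corrected if necessary by the fibre swap at `y₁` (trivial on `X`), is an element `g` acting
on `X` as `g₁` — so it moves `Ψ`, which contains exactly one of `x₁, ρx₁` — with `g y₁ = ρy₁'`; a four-case check over
`X = {x₀, ρx₀, x₁, ρx₁}` shows `gΘ ⊆ Θ` (§2).  Consumed (with `forall_map_slotExt_le_of_stabSep_pair` and the
irreducibility of `U(Ψ)` for a non-Galois quartic CM field) in `Summits/HodgeConjecture/CorCM/QuarticCMSubfieldOfOcticHodge`: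
a simple CM abelian surface with non-Galois CM field `K` times a simple CM abelian fourfold with CM by a non-Galois
octic `K' ⊃ K` is stably nondegenerate for EVERY pair of types — although `U(Ψ)` is a constituent of `U(Θ)`.
Theorems only; no definition, no named fact, no `sorry`.

## References

* [Kubota1965] T. Kubota, *On the field extension by complex multiplication*, Trans. AMS 118 (1965), §2 (p. 115:
  "a nondegenerate CM-type is primitive").
* [Gordon1999HodgeAVSurvey] B. B. Gordon, *A survey of the Hodge conjecture for abelian varieties*, §3 Theorem (proof),
  7.5–7.7.
* [MoonenZarhin1999LowDim] B. Moonen, Yu. Zarhin, *Hodge classes on abelian varieties of low dimension*, Math. Ann. 315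
  (1999), "Hodge groups of simple abelian surfaces of CM-type" (the stabiliser-separation mechanism one dimension down).
* [Shimura1998] G. Shimura, *Abelian Varieties with Complex Multiplication and Modular Functions*, §8.4 Example (2)(C)
  (the dihedral group of a non-Galois quartic CM field and its reflections).
-/

set_option autoImplicit false

noncomputable section

namespace Literature.NumberTheory.ComplexMultiplication

variable {G : Type*} [Group G] {X Y : Type*} [MulAction G X] [MulAction G Y]

/-! ### §1 Fibres of an equivariant two-to-one map and the two fibres singled out by a nondegenerate type -/

section Fibres

variable {π : Y → X} {ν : Y → G}

/-- In a fibre with at most two elements, everything is `y` or the given second element `y'`. [folklore] -/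
private theorem eq_or_eq_of_fibre
    (hfib : ∀ y₁ y₂ y₃ : Y, π y₁ = π y₂ → π y₂ = π y₃ → y₁ = y₂ ∨ y₂ = y₃ ∨ y₁ = y₃)
    {y y' z : Y} (hy' : π y' = π y) (hne : y' ≠ y) (hz : π z = π y) : z = y ∨ z = y' := by
  rcases hfib z y y' hz hy'.symm with h | h | h
  · exact Or.inl h
  · exact absurd h.symm hne
  · exact Or.inr h

/-- The fibre mate `ν_y y` (`ν_y` trivial on `X`) lies in the fibre of `y`. [folklore] -/
private theorem pi_mate (hπ : ∀ (g : G) (y : Y), π (g • y) = g • π y) (hνX : ∀ (y : Y) (x : X), ν y • x = x)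
    (y : Y) : π (ν y • y) = π y := by
  rw [hπ, hνX]

/-- The fibre of `y` is `{y, ν_y y}`. [folklore] -/
private theorem eq_or_eq_mate (hπ : ∀ (g : G) (y : Y), π (g • y) = g • π y)
    (hfib : ∀ y₁ y₂ y₃ : Y, π y₁ = π y₂ → π y₂ = π y₃ → y₁ = y₂ ∨ y₂ = y₃ ∨ y₁ = y₃)
    (hνX : ∀ (y : Y) (x : X), ν y • x = x) (hνy : ∀ y : Y, ν y • y ≠ y) {y z : Y} (hz : π z = π y) :
    z = y ∨ z = ν y • y :=
  eq_or_eq_of_fibre hfib (pi_mate hπ hνX y) (hνy y) hz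

/-- **Group elements carry fibre mates to fibre mates**: `g (ν_y y) = ν_{gy} (g y)`. [folklore] -/
private theorem smul_mate (hπ : ∀ (g : G) (y : Y), π (g • y) = g • π y)
    (hfib : ∀ y₁ y₂ y₃ : Y, π y₁ = π y₂ → π y₂ = π y₃ → y₁ = y₂ ∨ y₂ = y₃ ∨ y₁ = y₃)
    (hνX : ∀ (y : Y) (x : X), ν y • x = x) (hνy : ∀ y : Y, ν y • y ≠ y) (g : G) (y : Y) :
    g • (ν y • y) = ν (g • y) • (g • y) := by
  have hz : π (g • ν y • y) = π (g • y) := by rw [hπ, pi_mate hπ hνX, hπ]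
  rcases eq_or_eq_mate hπ hfib hνX hνy hz with h | h
  · exact absurd (smul_left_cancel g h) (hνy y)
  · exact h

/-- The mate of the mate is the point itself. [folklore] -/
private theorem mate_mate (hπ : ∀ (g : G) (y : Y), π (g • y) = g • π y)
    (hfib : ∀ y₁ y₂ y₃ : Y, π y₁ = π y₂ → π y₂ = π y₃ → y₁ = y₂ ∨ y₂ = y₃ ∨ y₁ = y₃)
    (hνX : ∀ (y : Y) (x : X), ν y • x = x) (hνy : ∀ y : Y, ν y • y ≠ y) (y : Y) :
    ν (ν y • y) • (ν y • y) = y := by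
  have hz : π (ν (ν y • y) • (ν y • y)) = π y := by rw [pi_mate hπ hνX, pi_mate hπ hνX]
  rcases eq_or_eq_mate hπ hfib hνX hνy hz with h | h
  · exact h
  · exact absurd h (hνy _)

variable [Fintype Y] [DecidableEq Y] [Nonempty Y] {ρ : G} {Θ : Set Y}

/-- **A nondegenerate type contains a whole fibre**: some `y₀` with `y₀ ∈ Θ` and `ν_{y₀} y₀ ∈ Θ` (`ρ` without fixed
points on `X`).  Otherwise every fibre would meet `Θ` in exactly one point, `ν_y y` would lie in the same translates of
`Θ` as `ρy`, and Kubota's separation for nondegenerate types would force `ν_y y = ρy`, which has the wrong image in `X`.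
[cite: Kubota1965, §2 (p. 115)] -/
theorem exists_mem_and_mate_mem_of_typeRank_eq (hΘ : IsCMTypeWith ρ Θ)
    (hπ : ∀ (g : G) (y : Y), π (g • y) = g • π y)
    (hfib : ∀ y₁ y₂ y₃ : Y, π y₁ = π y₂ → π y₂ = π y₃ → y₁ = y₂ ∨ y₂ = y₃ ∨ y₁ = y₃)
    (hνX : ∀ (y : Y) (x : X), ν y • x = x) (hνy : ∀ y : Y, ν y • y ≠ y) (hρX : ∀ x : X, ρ • x ≠ x)
    (hnd : typeRank G Θ = Fintype.card Y / 2 + 1) : ∃ y₀ : Y, y₀ ∈ Θ ∧ ν y₀ • y₀ ∈ Θ := by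
  by_contra hall
  push Not at hall
  -- every fibre is split: `z ∈ Θ ↔ ν_z z ∉ Θ`
  have hbal : ∀ z : Y, z ∈ Θ ↔ ν z • z ∉ Θ := by
    refine fun z => ⟨hall z, fun hz => ?_⟩
    by_contra hz'
    have h1 := hall (ρ • z) ((hΘ.rho_smul_mem_iff z).2 hz')
    rw [← smul_mate hπ hfib hνX hνy ρ z, hΘ.rho_smul_mem_iff] at h1
    exact h1 hz
  obtain ⟨y⟩ := ‹Nonempty Y›
  have hsep : ν y • y = ρ • y := by
    refine hΘ.eq_of_forall_smul_mem_iff_of_typeRank_eq hnd fun g => ?_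
    rw [smul_mate hπ hfib hνX hνy g y, hΘ.comm, hΘ.rho_smul_mem_iff]
    rw [hbal (g • y), not_not]
  have hπy : π (ρ • y) = π y := by rw [← hsep, pi_mate hπ hνX]
  rw [hπ] at hπy
  exact hρX (π y) hπy

/-- **A nondegenerate type splits some fibre**: some `y₁` with `y₁ ∈ Θ` and `ν_{y₁} y₁ ∉ Θ`.  Otherwise `Θ` would be a
union of fibres (induced from the bottom field) and `y`, `ν_y y` would lie in the same translates of `Θ` — Kubota: "a
nondegenerate CM-type is primitive". [cite: Kubota1965, §2 (p. 115)] -/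
theorem exists_mem_and_mate_not_mem_of_typeRank_eq (hΘ : IsCMTypeWith ρ Θ)
    (hπ : ∀ (g : G) (y : Y), π (g • y) = g • π y)
    (hfib : ∀ y₁ y₂ y₃ : Y, π y₁ = π y₂ → π y₂ = π y₃ → y₁ = y₂ ∨ y₂ = y₃ ∨ y₁ = y₃)
    (hνX : ∀ (y : Y) (x : X), ν y • x = x) (hνy : ∀ y : Y, ν y • y ≠ y)
    (hnd : typeRank G Θ = Fintype.card Y / 2 + 1) : ∃ y₁ : Y, y₁ ∈ Θ ∧ ν y₁ • y₁ ∉ Θ := by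
  by_contra hall
  push Not at hall
  -- membership is constant on fibres
  have hconst : ∀ z : Y, z ∈ Θ ↔ ν z • z ∈ Θ := by
    refine fun z => ⟨hall z, fun hz => ?_⟩
    by_contra hz'
    have h1 := hall (ρ • z) ((hΘ.rho_smul_mem_iff z).2 hz')
    rw [← smul_mate hπ hfib hνX hνy ρ z, hΘ.rho_smul_mem_iff] at h1
    exact h1 hz
  obtain ⟨y⟩ := ‹Nonempty Y›
  have hsep : y = ν y • y := by
    refine hΘ.eq_of_forall_smul_mem_iff_of_typeRank_eq hnd fun g => ?_
    rw [smul_mate hπ hfib hνX hνy g y]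
    exact hconst (g • y)
  exact hνy y hsep.symm

end Fibres

/-! ### §2 The separating element -/

section Separation

/-- **Stabiliser separation for a quadratic tower.**  Let `π : Y → X` be `G`-equivariant with fibres of at most two
elements, each point `y` having a fibre mate `n y ≠ y` for some `n ∈ G` acting trivially on `X`; let `X` consist of two
conjugate pairs through any `x' ∉ {x, ρx}`, with the pair conjugations `x ↦ x`, `x' ↦ ρx'` realised in `G`; let
`Ψ ⊆ X` be a CM type and `Θ ⊆ Y` a NONDEGENERATE CM type (for the commuting conjugation `ρ`).  Then some `g ∈ G`
stabilises `Θ` (`g⁻¹Θ = Θ`) and moves `Ψ`.  (The situation of `Hom(K', ℂ) → Hom(K, ℂ)` for a non-Galois quartic CM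
field `K` and a quadratic CM extension `K'` of `K` outside the Galois closure of `K`.)
[cite: Gordon1999HodgeAVSurvey, §3 Theorem (proof)] [cite: Kubota1965, §2 (p. 115)] [cite: Shimura1998, §8.4 Example (2)(C)] -/
theorem exists_typeStab_and_not_of_quadraticTower [Fintype Y] [DecidableEq Y] [Nonempty Y] {ρ : G} {Ψ : Set X}
    {Θ : Set Y} (hΨ : IsCMTypeWith ρ Ψ) (hΘ : IsCMTypeWith ρ Θ) (π : Y → X)
    (hπ : ∀ (g : G) (y : Y), π (g • y) = g • π y)
    (hfib : ∀ y₁ y₂ y₃ : Y, π y₁ = π y₂ → π y₂ = π y₃ → y₁ = y₂ ∨ y₂ = y₃ ∨ y₁ = y₃)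
    (hN : ∀ y : Y, ∃ n : G, (∀ x : X, n • x = x) ∧ n • y ≠ y)
    (hX : ∀ x x' : X, x' ≠ x → x' ≠ ρ • x → ∀ z : X, z = x ∨ z = ρ • x ∨ z = x' ∨ z = ρ • x')
    (hconj : ∀ x x' : X, x' ≠ x → x' ≠ ρ • x → ∃ g : G, g • x = x ∧ g • x' = ρ • x')
    (hnd : typeRank G Θ = Fintype.card Y / 2 + 1) :
    ∃ g : G, (∀ y : Y, g • y ∈ Θ ↔ y ∈ Θ) ∧ ∃ x : X, ¬(g • x ∈ Ψ ↔ x ∈ Ψ) := by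
  classical
  choose ν hνX hνy using hN
  -- fibre bookkeeping
  have hfibre : ∀ {y z : Y}, π z = π y → z = y ∨ z = ν y • y := fun {y z} hz =>
    eq_or_eq_mate hπ hfib hνX hνy hz
  have hmate : ∀ (g : G) (y : Y), g • (ν y • y) = ν (g • y) • (g • y) := fun g y =>
    smul_mate hπ hfib hνX hνy g y
  have hmm : ∀ y : Y, ν (ν y • y) • (ν y • y) = y := fun y => mate_mate hπ hfib hνX hνy y
  -- §1: the full fibre `{y₀, ν y₀}` inside `Θ` and the split fibre `{y₁ ∈ Θ, ν y₁ ∉ Θ}`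
  obtain ⟨y₀, hy₀, hy₀'⟩ :=
    exists_mem_and_mate_mem_of_typeRank_eq hΘ hπ hfib hνX hνy hΨ.rho_smul_ne hnd
  obtain ⟨y₁, hy₁, hy₁'⟩ := exists_mem_and_mate_not_mem_of_typeRank_eq hΘ hπ hfib hνX hνy hnd
  -- the base points `x₀ = π y₀`, `x₁ = π y₁` lie in different conjugate pairs
  have hx₁₀ : π y₁ ≠ π y₀ := by
    intro heq
    rcases hfibre heq with h | h
    · rw [h] at hy₁'; exact hy₁' hy₀'
    · rw [h, hmm] at hy₁'; exact hy₁' hy₀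
  have hx₁₀' : π y₁ ≠ ρ • π y₀ := by
    intro heq
    rw [← hπ] at heq
    rcases hfibre heq with h | h
    · rw [h] at hy₁; exact (hΘ.rho_smul_mem_iff y₀).1 hy₁ hy₀
    · rw [h, ← hmate] at hy₁; exact (hΘ.rho_smul_mem_iff _).1 hy₁ hy₀'
  -- the pair conjugation fixing `x₀` and conjugating `x₁`, corrected on the fibre of `y₁` if necessary
  obtain ⟨g₁, hg₁₀, hg₁₁⟩ := hconj (π y₀) (π y₁) hx₁₀ hx₁₀'
  have hg₁y₁ : g₁ • y₁ = ρ • y₁ ∨ g₁ • y₁ = ρ • ν y₁ • y₁ := by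
    have hz : π (g₁ • y₁) = π (ρ • y₁) := by rw [hπ, hg₁₁, hπ]
    rcases hfibre hz with h | h
    · exact Or.inl h
    · right; rw [h, hmate]
  obtain ⟨g, hgX, hgy₁⟩ : ∃ g : G, (∀ x : X, g • x = g₁ • x) ∧ g • y₁ = ρ • ν y₁ • y₁ := by
    rcases hg₁y₁ with h | h
    · refine ⟨g₁ * ν y₁, fun x => by rw [mul_smul, hνX], ?_⟩
      rw [mul_smul, hmate, h, ← hmate]
    · exact ⟨g₁, fun _ => rfl, h⟩
  have hgy₁' : g • ν y₁ • y₁ = ρ • y₁ := by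
    rw [hmate, hgy₁, ← hmate, hmm]
  have hgπ : ∀ y, π (g • y) = g₁ • π y := fun y => by rw [hπ, hgX]
  -- `gΘ ⊆ Θ`, by the four cases `π y ∈ {x₀, ρx₀, x₁, ρx₁}`
  have hinto : ∀ y : Y, y ∈ Θ → g • y ∈ Θ := by
    intro y hy
    rcases hX (π y₀) (π y₁) hx₁₀ hx₁₀' (π y) with h | h | h | h
    · -- over `x₀`: the whole fibre is in `Θ`, and `g` preserves it
      have hz : π (g • y) = π y₀ := by rw [hgπ, h, hg₁₀]
      rcases hfibre hz with h' | h'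
      · rw [h']; exact hy₀
      · rw [h']; exact hy₀'
    · -- over `ρ x₀`: no point of `Θ` lies there
      exfalso
      rw [← hπ] at h
      rcases hfibre h with h' | h'
      · rw [h'] at hy; exact (hΘ.rho_smul_mem_iff y₀).1 hy hy₀
      · rw [h', ← hmate] at hy; exact (hΘ.rho_smul_mem_iff _).1 hy hy₀'
    · -- over `x₁`: `y = y₁`
      rcases hfibre h with h' | h'
      · rw [h', hgy₁, hΘ.rho_smul_mem_iff]; exact hy₁'
      · rw [h'] at hy; exact absurd hy hy₁'
    · -- over `ρ x₁`: `y = ρ ν y₁`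
      rw [← hπ] at h
      rcases hfibre h with h' | h'
      · rw [h'] at hy; exact absurd hy₁ ((hΘ.rho_smul_mem_iff y₁).1 hy)
      · rw [h', ← hmate, hΘ.comm, hgy₁', hΘ.invol]; exact hy₁
  refine ⟨g, fun y => ⟨fun hgy => ?_, hinto y⟩, π y₁, fun h => ?_⟩
  · by_contra hy
    have h1 := hinto (ρ • y) ((hΘ.rho_smul_mem_iff y).2 hy)
    rw [hΘ.comm, hΘ.rho_smul_mem_iff] at h1
    exact h1 hgy
  · rw [hgX, hg₁₁, hΨ.rho_smul_mem_iff] at h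
    by_cases hm : π y₁ ∈ Ψ
    · exact (h.2 hm) hm
    · exact hm (h.1 hm)

end Separation

/-! ### §3 (appended) The separating element taken from the stabiliser of the unsplit point, moving a type on a third
`G`-set

For the reflex configuration (`Summits/HodgeConjecture/CorCM/QuarticCMReflexInOcticHodge`): the moved type `Ψ` lives
on a third `G`-set `Z` (`= Hom(K_S, ℂ)`, while `X = Hom(k', ℂ)` for the copy `k' ⊂ K_F` of the reflex field of `K_S`),
the unsplit fibre over `x₀ = π y₀` is given, and the element `h₀ ∈ Stab(x₀)` moving `Ψ` is given; elements trivial on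
`X` are trivial on `Z` (the two quartic fields have the same Galois closure).  Then `h₀` is a pair conjugation on `X`
(it cannot fix `X` pointwise, as it moves `Ψ`), and the construction of §2 runs with `g₁ = h₀`. -/

section ThirdSet

/-- **Stabiliser separation for a quadratic tower, reflex form.**  Data: `π : Y → X` equivariant with fibres of at
most two elements swapped by elements trivial on `X`; elements trivial on `X` act trivially on the third `G`-set `Z`;
`X` consists of two conjugate pairs through any `x' ∉ {x, ρx}`; a NONDEGENERATE CM type `Θ ⊆ Y` containing the whole
fibre of `y₀`; an element `h₀` fixing `π y₀` and moving the subset `Ψ ⊆ Z`.  Then some `g ∈ G` stabilises `Θ`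
(`g⁻¹Θ = Θ`) and moves `Ψ`. [cite: Kubota1965, §2 (p. 115)] [cite: Shimura1998, §8.4 Example (2)(C)]
[cite: MoonenZarhin1999LowDim, "Hodge groups of simple abelian surfaces of CM-type"] -/
theorem exists_typeStab_and_not_of_quadraticTower_of_smul_eq [Fintype Y] [DecidableEq Y] [Nonempty Y] {Z : Type*}
    [MulAction G Z] {ρ : G} {Ψ : Set Z} {Θ : Set Y} (hΘ : IsCMTypeWith ρ Θ) (π : Y → X)
    (hπ : ∀ (g : G) (y : Y), π (g • y) = g • π y)
    (hfib : ∀ y₁ y₂ y₃ : Y, π y₁ = π y₂ → π y₂ = π y₃ → y₁ = y₂ ∨ y₂ = y₃ ∨ y₁ = y₃)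
    (hN : ∀ y : Y, ∃ n : G, (∀ x : X, n • x = x) ∧ n • y ≠ y)
    (hL : ∀ n : G, (∀ x : X, n • x = x) → ∀ z : Z, n • z = z)
    (hX : ∀ x x' : X, x' ≠ x → x' ≠ ρ • x → ∀ z : X, z = x ∨ z = ρ • x ∨ z = x' ∨ z = ρ • x')
    {y₀ : Y} (hy₀ : ∀ y : Y, π y = π y₀ → y ∈ Θ) {h₀ : G} (hh₀ : h₀ • π y₀ = π y₀)
    (hh₀Ψ : ∃ z : Z, ¬(h₀ • z ∈ Ψ ↔ z ∈ Ψ)) (hnd : typeRank G Θ = Fintype.card Y / 2 + 1) :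
    ∃ g : G, (∀ y : Y, g • y ∈ Θ ↔ y ∈ Θ) ∧ ∃ z : Z, ¬(g • z ∈ Ψ ↔ z ∈ Ψ) := by
  classical
  choose ν hνX hνy using hN
  have hfibre : ∀ {y z : Y}, π z = π y → z = y ∨ z = ν y • y := fun {y z} hz =>
    eq_or_eq_mate hπ hfib hνX hνy hz
  have hmate : ∀ (g : G) (y : Y), g • (ν y • y) = ν (g • y) • (g • y) := fun g y =>
    smul_mate hπ hfib hνX hνy g y
  have hmm : ∀ y : Y, ν (ν y • y) • (ν y • y) = y := fun y => mate_mate hπ hfib hνX hνy y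
  have hy₀Θ : y₀ ∈ Θ := hy₀ y₀ rfl
  have hy₀Θ' : ν y₀ • y₀ ∈ Θ := hy₀ _ (by rw [hπ, hνX])
  -- `ρ` commutes with `G` on the image of `π`
  have hρcomm : ∀ (g : G) (y : Y), g • ρ • π y = ρ • g • π y := fun g y => by
    rw [← hπ, ← hπ, hΘ.comm, hπ, hπ]
  -- the split fibre
  obtain ⟨y₁, hy₁, hy₁'⟩ := exists_mem_and_mate_not_mem_of_typeRank_eq hΘ hπ hfib hνX hνy hnd
  have hx₁₀ : π y₁ ≠ π y₀ := fun heq => hy₁' (hy₀ _ (by rw [hπ, hνX, heq]))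
  have hx₁₀' : π y₁ ≠ ρ • π y₀ := by
    intro heq
    have h1 : π (ρ • y₁) = π y₀ := by rw [hπ, heq, ← hπ, ← hπ, hΘ.invol]
    exact (hΘ.rho_smul_mem_iff y₁).1 (hy₀ _ h1) hy₁
  -- `h₀` fixes `x₀`, `ρx₀` and is a pair conjugation on `{x₁, ρx₁}`: it cannot fix `X` pointwise
  have hh₀ρ : h₀ • ρ • π y₀ = ρ • π y₀ := by rw [hρcomm, hh₀]
  have hh₀₁ : h₀ • π y₁ = ρ • π y₁ := by
    rcases hX (π y₀) (π y₁) hx₁₀ hx₁₀' (h₀ • π y₁) with h | h | h | h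
    · exact absurd (smul_left_cancel h₀ (h.trans hh₀.symm)) hx₁₀
    · exact absurd (smul_left_cancel h₀ (h.trans hh₀ρ.symm)) hx₁₀'
    · exfalso
      have hall : ∀ x : X, h₀ • x = x := by
        intro x
        rcases hX (π y₀) (π y₁) hx₁₀ hx₁₀' x with hx | hx | hx | hx <;> rw [hx]
        · exact hh₀
        · exact hh₀ρ
        · exact h
        · rw [hρcomm, h]
      obtain ⟨z, hz⟩ := hh₀Ψ
      exact hz (by rw [hL h₀ hall z])
    · exact h
  -- as in §2 with `g₁ = h₀`
  have hg₁y₁ : h₀ • y₁ = ρ • y₁ ∨ h₀ • y₁ = ρ • ν y₁ • y₁ := by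
    have hz : π (h₀ • y₁) = π (ρ • y₁) := by rw [hπ, hh₀₁, hπ]
    rcases hfibre hz with h | h
    · exact Or.inl h
    · right; rw [h, hmate]
  obtain ⟨g, hgX, hgZ, hgy₁⟩ : ∃ g : G, (∀ x : X, g • x = h₀ • x) ∧ (∀ z : Z, g • z = h₀ • z) ∧
      g • y₁ = ρ • ν y₁ • y₁ := by
    rcases hg₁y₁ with h | h
    · refine ⟨h₀ * ν y₁, fun x => by rw [mul_smul, hνX], fun z => by rw [mul_smul, hL _ (hνX y₁) z], ?_⟩
      rw [mul_smul, hmate, h, ← hmate]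
    · exact ⟨h₀, fun _ => rfl, fun _ => rfl, h⟩
  have hgy₁' : g • ν y₁ • y₁ = ρ • y₁ := by
    rw [hmate, hgy₁, ← hmate, hmm]
  have hgπ : ∀ y, π (g • y) = h₀ • π y := fun y => by rw [hπ, hgX]
  have hinto : ∀ y : Y, y ∈ Θ → g • y ∈ Θ := by
    intro y hy
    rcases hX (π y₀) (π y₁) hx₁₀ hx₁₀' (π y) with h | h | h | h
    · exact hy₀ _ (by rw [hgπ, h, hh₀])
    · exfalso
      rw [← hπ] at h
      rcases hfibre h with h' | h'
      · rw [h'] at hy; exact (hΘ.rho_smul_mem_iff y₀).1 hy hy₀Θ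
      · rw [h', ← hmate] at hy; exact (hΘ.rho_smul_mem_iff _).1 hy hy₀Θ'
    · rcases hfibre h with h' | h'
      · rw [h', hgy₁, hΘ.rho_smul_mem_iff]; exact hy₁'
      · rw [h'] at hy; exact absurd hy hy₁'
    · rw [← hπ] at h
      rcases hfibre h with h' | h'
      · rw [h'] at hy; exact absurd hy₁ ((hΘ.rho_smul_mem_iff y₁).1 hy)
      · rw [h', ← hmate, hΘ.comm, hgy₁', hΘ.invol]; exact hy₁
  obtain ⟨z, hz⟩ := hh₀Ψ
  refine ⟨g, fun y => ⟨fun hgy => ?_, hinto y⟩, z, by rw [hgZ]; exact hz⟩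
  by_contra hy
  have h1 := hinto (ρ • y) ((hΘ.rho_smul_mem_iff y).2 hy)
  rw [hΘ.comm, hΘ.rho_smul_mem_iff] at h1
  exact h1 hgy

end ThirdSet

end Literature.NumberTheory.ComplexMultiplication

end
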